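import Literature.AlgebraicGeometry.HodgeTheory.ChernCharacterLawsLeadingTermShape
import Literature.AlgebraicGeometry.HodgeTheory.SaitoGrFDeRhamCurveNetHolds
import Literature.AlgebraicGeometry.HodgeTheory.SupportedClassesSemipurity
import Literature.AlgebraicGeometry.HodgeTheory.GysinKernelProofs
import HarnessLib

/-!
# `ch_k` of a coherent sheaf supported on a Zariski-closed subset: coniveau, semipurity, and Deligne's Gysin shape in the codimension

Family `hodge`, layer `Literature/AlgebraicGeometry/HodgeTheory`. HONEST FRAMING: nothing here constructs a Chern character or bears
on any case of the Hodge conjecture; `ChernCharacterBetti` stays a hypothesis structure without an instance, and no coefficient of a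
Riemann–Roch formula is computed. Sequel to `HodgeTheory/ChernCharacterLawsLeadingTermShape` (the same statements for a SMOOTH
support, by Thom–Gysin), now for an ARBITRARY Zariski-closed support, by Deligne's Cor. 8.2.8 — a THEOREM of the tree
(`Deligne1974_ker_restrictCompl_eq_iSup_range_complexGysin_holds`): classes dying off `Z = ⋃ⱼ gⱼ(Yⱼ)` are sums of Gysin images
`(gⱼ)_*`.

For `X` smooth projective over `ℂ` of dimension `n`, a Zariski-closed `Z ⊆ X`, a coherent sheaf `F` on `X` SUPPORTED ON `Z` (its
inverse image on every open `W` disjoint from `Z` vanishes), and a raw datum `ch` additive on short exact sequences of vector bundles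
and functorial along `ℂ`-morphisms:

* §1 `restrictCompl_eq_zero_of_map_eq_zero_of_range_eq_compl` — transport: a class killed by `u(ℂ)^*` for an open immersion `u`
  onto `X ∖ Z` restricts to zero on `(X ∖ Z)(ℂ)` (the tree's `restrictCompl_eq_zero_of_map_eq_zero`, which asks `Z` to be the image
  of a morphism, verbatim for an arbitrary `Z`);
* §2 `ChernDatum.restrictCompl_chKZeroCoh_eq_zero_of_isClosed` — **`ch_k(F)` dies on `(X ∖ Z)(ℂ)`**; hence
  `ChernDatum.chKZeroCoh_mem_supportedClasses` — **`ch_k(F) ∈ Nᶜ H²ᵏ(X(ℂ); ℂ)` when every point of `Z` has codimension `≥ c`**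
  (Grothendieck's coniveau), and `ChernDatum.chKZeroCoh_eq_zero_of_lt_coheight` — **`ch_k(F) = 0` for `k < c`** (semipurity
  `Nᶜ H^{<2c} = 0`, `supportedClasses_eq_bot_of_lt`);
* §3 `ChernDatum.exists_chKZeroCoh_eq_sum_smul_complexGysin_one` — **Deligne's shape in the codimension**: if `Z = ⋃ⱼ gⱼ(Yⱼ)` for
  finitely many `gⱼ : Yⱼ ⟶ X` from smooth projective `Yⱼ` of dimension `d = n − p` (resolutions of the components of a `Z` of pure
  codimension `p`, say), then `ch_p(F) = Σⱼ cⱼ • (gⱼ)_* 1_{Yⱼ}` for SOME scalars `cⱼ` (`H⁰(Yⱼ(ℂ); ℂ) = ℂ · 1`); one map: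
  `ChernDatum.exists_chKZeroCoh_eq_smul_complexGysin_one_of_range_eq`; and the span corollary
  `ChernDatum.complexGysin_one_mem_span_ch_of_range_eq_of_ne_zero` — the Gysin generator `g_* 1_Y` of `Nᵖ H²ᵖ` along a morphism
  `g : Y ⟶ X` ONTO a closed `Z` (e.g. a resolution of an irreducible codimension-`p` subvariety) lies in `ℂ · {ch_p(E)}` as soon as
  `ch_p(F) ≠ 0` for one coherent `F` supported on `Z` (e.g. `F = 𝒪_Z`): for the span law of the crux line `grothendieck_axiomatic`
  (stmt-HodgeConjecture-19780, `stub_spanForOne`) the remaining input on EVERY generator is the non-vanishing of a leading coefficient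
  — no Riemann–Roch for a projection is needed in this formulation (Fulton Example 15.3.5: `c_p(𝒪_Z) = (−1)^{p−1}(p−1)! [Z]` for a possibly
  singular `Z`, whose coefficient is not claimed here).

Everything is proved; no definition, no named fact, no instance, no notation.

## References

* [DeligneHodgeIII1974] P. Deligne, Théorie de Hodge III, Publ. Math. IHÉS 44 (1974): Prop. 8.2.7, Cor. 8.2.8.
* [GrothendieckTopology1969] A. Grothendieck, Hodge's general conjecture is false for trivial reasons, Topology 8 (1969): §1.
* [Fulton1998] W. Fulton, Intersection Theory, 2nd ed. (1998): §15.1, Thm. 15.2, Example 15.3.5, Example 15.2.16 (b), §19.1.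
* [VoisinHodgeI2002] C. Voisin, Hodge Theory and Complex Algebraic Geometry I (2002): §11.1.2 (Lemma 11.13).
* [Hartshorne1977] R. Hartshorne, Algebraic Geometry (1977): III Ex. 6.9, III Prop. 9.2.
* Tree: `HodgeTheory/ChernCharacterLawsLeadingTermShape`, `HodgeTheory/GysinKernel` + `SaitoGrFDeRhamCurveNetHolds` (Deligne 8.2.8,
  discharged), `HodgeTheory/SupportedClassesSemipurity`, `HodgeTheory/AlgebraicClasses`, `HodgeTheory/AffineLineBundleCohomology`.
-/

noncomputable section

open CategoryTheory CategoryTheory.Limits AlgebraicGeometry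
open Literature.AlgebraicTopology.SingularHomology
open Literature.AlgebraicGeometry.Motives Literature.AlgebraicGeometry.Modules Literature.AlgebraicGeometry.Morphisms
open Literature.AlgebraicGeometry.KTheory

namespace Literature.AlgebraicGeometry.HodgeTheory

section HodgeTheory

variable {n : ℕ} {X : SchemeOver ℂ}

/-! ### §1 Transport: restriction to `(X ∖ Z)(ℂ)` is the pull-back along the open subscheme `X ∖ Z` -/

/-- The complex points of an open immersion `u : U ↪ X` whose image is the complement of a subset `Z ⊆ X` form the open subspace
`(X ∖ Z)(ℂ)`; a class killed by `u(ℂ)^*` restricts to zero on `(X ∖ Z)(ℂ)` (the tree's `restrictCompl_eq_zero_of_map_eq_zero`, stated there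
for `Z` the image of a morphism, verbatim for any `Z`). [cite: GrothendieckTopology1969, §1] -/
-- adapted from `HodgeTheory/AffineLineBundleCohomology.restrictCompl_eq_zero_of_map_eq_zero` (same proof, `Set.range σ` ↦ `Z`)
theorem restrictCompl_eq_zero_of_map_eq_zero_of_range_eq_compl {U : SchemeOver ℂ} (Z : Set X.left) (u : U ⟶ X)
    [IsOpenImmersion u.left] (hu : Set.range u.left.base = Zᶜ) (a : ℕ) (x : complexBetti X a)
    (hx : complexBetti.map u a x = 0) : complexBetti.restrictCompl X Z a x = 0 := by
  set uC : C(ComplexPoints U, ComplexPoints X) := AlgPoints.mapContinuous (L := ℂ) u with huC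
  have hue : Topology.IsOpenEmbedding uC := AlgPoints.isOpenEmbedding_map_holds u
  have hrange : Set.range uC = {Q : ComplexPoints X | Q.pt ∉ Z} := by
    change Set.range (AlgPoints.map u) = _
    rw [AlgPoints.range_map_of_isOpenImmersion_holds u]
    ext Q
    change Q.pt ∈ (u.left.opensRange : Set X.left) ↔ Q.pt ∉ Z
    rw [Scheme.Hom.coe_opensRange, hu]
    rfl
  -- the homeomorphism `U(ℂ) ≃ (X ∖ Z)(ℂ)`
  let θ : ComplexPoints U ≃ₜ complexPointsCompl X Z := hue.isEmbedding.toHomeomorph.trans (Homeomorph.setCongr hrange)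
  have hval : (⟨Subtype.val, continuous_subtype_val⟩ : C(complexPointsCompl X Z, ComplexPoints X)) =
      uC.comp (θ.symm : C(complexPointsCompl X Z, ComplexPoints U)) := by
    refine ContinuousMap.ext fun Q ↦ ?_
    obtain ⟨Q', rfl⟩ := θ.surjective Q
    change ((θ Q' : complexPointsCompl X Z) : ComplexPoints X) = uC (θ.symm (θ Q'))
    rw [θ.symm_apply_apply]
    rfl
  change singularCohomology.map ℂ ℂ (⟨Subtype.val, continuous_subtype_val⟩ :
      C(complexPointsCompl X Z, ComplexPoints X)) a x = 0
  have hx' : (singularCohomology.map ℂ ℂ uC a) x = 0 := hx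
  rw [hval, singularCohomology.map_comp, ConcreteCategory.comp_apply, hx', map_zero]

namespace ChernDatum

variable (ch : ChernDatum)
  (hadd : ∀ {X : SchemeOver ℂ} (S : ShortComplex X.left.Modules), S.ShortExact →
    IsVectorBundle S.X₁ → IsVectorBundle S.X₃ → ∀ i : ℕ, ch X S.X₂ i = ch X S.X₁ i + ch X S.X₃ i)
  (hmap : ∀ {X Y : SchemeOver ℂ} (f : Y ⟶ X) (E : X.left.Modules), IsVectorBundle E →
    ∀ i : ℕ, complexBetti.map f (2 * i) (ch X E i) = ch Y ((Scheme.Modules.pullback f.left).obj E) i)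

include hmap

/-! ### §2 Coniveau and semipurity of `ch_k` of a supported sheaf -/

/-- **`ch_k(F)` restricts to `0` on `(X ∖ Z)(ℂ)` when the coherent `F` is supported on the Zariski-closed `Z`** (hypothesis: the
inverse image of `F` on every open disjoint from `Z` vanishes): functoriality of `ch` along the open immersion `X ∖ Z ↪ X`, where the
class of `F` dies (`map_chKZeroCoh_eq_zero_of_isZero_pullback`). [cite: Fulton1998, §15.1 (ii) with App. B.8.3]
[cite: GrothendieckTopology1969, §1] -/
theorem restrictCompl_chKZeroCoh_eq_zero_of_isClosed (hX : IsSmoothProjective n X) {Z : Set X.left} (hZ : IsClosed Z)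
    {F : X.left.Modules} (hF : Coh F)
    (h0 : ∀ W : X.left.Opens, Disjoint (W : Set X.left) Z → IsZero ((Scheme.Modules.pullback W.ι).obj F)) (k : ℕ) :
    complexBetti.restrictCompl X Z (2 * k) (chKZeroCoh ch hadd hX k (KZeroCoh.of F hF)) = 0 := by
  let W : X.left.Opens := ⟨Zᶜ, hZ.isOpen_compl⟩
  let U : SchemeOver ℂ := Over.mk (W.ι ≫ X.hom)
  let u : U ⟶ X := Over.homMk W.ι
  have hu : Set.range u.left.base = Zᶜ := by
    change Set.range W.ι.base = _
    rw [Scheme.Opens.range_ι]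
    rfl
  haveI : IsOpenImmersion u.left := inferInstanceAs (IsOpenImmersion W.ι)
  haveI : Flat u.left := inferInstance
  refine restrictCompl_eq_zero_of_map_eq_zero_of_range_eq_compl Z u hu (2 * k) _ ?_
  exact map_chKZeroCoh_eq_zero_of_isZero_pullback ch hadd hmap hX u hF (h0 W (Set.disjoint_compl_left_iff_subset.2 subset_rfl)) k

/-- **`ch_k(F) ∈ Nᶜ H²ᵏ(X(ℂ); ℂ)`** for `F` coherent supported on a Zariski-closed `Z` all of whose points have codimension `≥ c`
(Grothendieck's coniveau: classes dying off a closed subset of codimension `≥ c`). [cite: GrothendieckTopology1969, §1]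
[cite: Fulton1998, §19.1] -/
theorem chKZeroCoh_mem_supportedClasses (hX : IsSmoothProjective n X) {Z : Set X.left} (hZ : IsClosed Z) {c : ℕ}
    (hc : ∀ z ∈ Z, (c : ℕ∞) ≤ Order.coheight z) {F : X.left.Modules} (hF : Coh F)
    (h0 : ∀ W : X.left.Opens, Disjoint (W : Set X.left) Z → IsZero ((Scheme.Modules.pullback W.ι).obj F)) (k : ℕ) :
    chKZeroCoh ch hadd hX k (KZeroCoh.of F hF) ∈ supportedClasses X (2 * k) c :=
  mem_supportedClasses_of_restrictCompl_eq_zero hZ hc (restrictCompl_chKZeroCoh_eq_zero_of_isClosed ch hadd hmap hX hZ hF h0 k)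

/-- **Semipurity: `ch_k(F) = 0` for `k` below the codimension of the support** (`Nᶜ H²ᵏ = 0` for `2k < 2c`).
[cite: GrothendieckTopology1969, §1] [cite: VoisinHodgeI2002, §11.1.2 Lemma 11.13] [cite: Fulton1998, Example 15.3.5] -/
theorem chKZeroCoh_eq_zero_of_lt_coheight (hX : IsSmoothProjective n X) {Z : Set X.left} (hZ : IsClosed Z) {c : ℕ}
    (hc : ∀ z ∈ Z, (c : ℕ∞) ≤ Order.coheight z) {F : X.left.Modules} (hF : Coh F)
    (h0 : ∀ W : X.left.Opens, Disjoint (W : Set X.left) Z → IsZero ((Scheme.Modules.pullback W.ι).obj F)) {k : ℕ} (hk : k < c) :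
    chKZeroCoh ch hadd hX k (KZeroCoh.of F hF) = 0 := by
  have h := chKZeroCoh_mem_supportedClasses ch hadd hmap hX hZ hc hF h0 k
  rw [supportedClasses_eq_bot_of_lt hX (by omega : 2 * k < 2 * c)] at h
  exact (Submodule.mem_bot ℂ).1 h

/-! ### §3 Deligne's Gysin shape in the codimension -/

/-- **Deligne's shape in the codimension**: for `X` smooth projective of dimension `n = d + p`, finitely many `gⱼ : Yⱼ ⟶ X` from
smooth projective `Yⱼ` of dimension `d`, and a coherent `F` supported on `Z = ⋃ⱼ gⱼ(Yⱼ)`, there are scalars `cⱼ` with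
**`ch_p(F) = Σⱼ cⱼ • (gⱼ)_* 1_{Yⱼ}`**: `ch_p(F)` dies off `Z`, so lies in `Σⱼ (gⱼ)_* H⁰(Yⱼ(ℂ); ℂ)` (Deligne, Hodge III, Cor. 8.2.8 — the
tree's theorem; the degree bookkeeping leaves only `H⁰ = ℂ · 1`). [cite: DeligneHodgeIII1974, Cor. 8.2.8]
[cite: Fulton1998, Example 15.3.5 and §19.1 Lemma 19.1.1] -/
theorem exists_chKZeroCoh_eq_sum_smul_complexGysin_one (μ : OrientationFamily) (hX : IsSmoothProjective n X) {p d : ℕ}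
    (hdp : d + p = n) {ι : Type} [Fintype ι] {Y : ι → SchemeOver ℂ} (hY : ∀ j, IsSmoothProjective d (Y j)) (g : ∀ j, Y j ⟶ X)
    {F : X.left.Modules} (hF : Coh F)
    (h0 : ∀ W : X.left.Opens, Disjoint (W : Set X.left) (⋃ j, Set.range (g j).left.base) →
      IsZero ((Scheme.Modules.pullback W.ι).obj F)) :
    ∃ c : ι → ℂ, chKZeroCoh ch hadd hX p (KZeroCoh.of F hF) =
      ∑ j, c j • complexGysin μ (hY j) hX (g j) (a := 0) (b := 2 * p) (by omega) (singularCohomology.one ℂ (ComplexPoints (Y j))) := by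
  have hZ : IsClosed (⋃ j, Set.range (g j).left.base) := isClosed_iUnion_range_of_isSmoothProjective hX hY g
  have hker : chKZeroCoh ch hadd hX p (KZeroCoh.of F hF) ∈
      LinearMap.ker (complexBetti.restrictCompl X (⋃ j, Set.range (g j).left.base) (2 * p)).hom :=
    restrictCompl_chKZeroCoh_eq_zero_of_isClosed ch hadd hmap hX hZ hF h0 p
  rw [Deligne1974_ker_restrictCompl_eq_iSup_range_complexGysin_holds μ μ.hasPoincareDuality hX hY g (2 * p)] at hker
  -- the sum of Gysin images in degree `2p` is spanned by the `(gⱼ)_* 1`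
  have hle : (⨆ (j : ι) (a : ℕ) (hab : a + 2 * n = 2 * p + 2 * d), LinearMap.range (complexGysin μ (hY j) hX (g j) hab)) ≤
      Submodule.span ℂ (Set.range fun j ↦
        complexGysin μ (hY j) hX (g j) (a := 0) (b := 2 * p) (by omega) (singularCohomology.one ℂ (ComplexPoints (Y j)))) := by
    refine iSup_le fun j ↦ iSup_le fun a ↦ iSup_le fun hab ↦ ?_
    obtain rfl : a = 0 := by omega
    rintro _ ⟨y, rfl⟩
    haveI := pathConnectedSpace_complexPoints_of_isSmoothProjective (hY j)
    rw [singularCohomology.eq_smul_one ℂ y, map_smul]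
    exact Submodule.smul_mem _ _ (Submodule.subset_span ⟨j, rfl⟩)
  obtain ⟨c, hc⟩ := (Submodule.mem_span_range_iff_exists_fun ℂ).1 (hle hker)
  exact ⟨c, hc.symm⟩

/-- **One map**: for `g : Y ⟶ X` from a smooth projective `Y` of dimension `d = n − p` (e.g. a resolution of an irreducible
codimension-`p` subvariety `Z = g(Y)`) and `F` coherent supported on `g(Y)`, **`ch_p(F) = c • g_* 1_Y` for some `c ∈ ℂ`**.
[cite: DeligneHodgeIII1974, Cor. 8.2.8] [cite: Fulton1998, Example 15.3.5] -/
theorem exists_chKZeroCoh_eq_smul_complexGysin_one_of_range_eq (μ : OrientationFamily) (hX : IsSmoothProjective n X) {p d : ℕ}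
    (hdp : d + p = n) {Y : SchemeOver ℂ} (hY : IsSmoothProjective d Y) (g : Y ⟶ X) {F : X.left.Modules} (hF : Coh F)
    (h0 : ∀ W : X.left.Opens, Disjoint (W : Set X.left) (Set.range g.left.base) → IsZero ((Scheme.Modules.pullback W.ι).obj F)) :
    ∃ c : ℂ, chKZeroCoh ch hadd hX p (KZeroCoh.of F hF) =
      c • complexGysin μ hY hX g (a := 0) (b := 2 * p) (by omega) (singularCohomology.one ℂ (ComplexPoints Y)) := by
  obtain ⟨c, hc⟩ := exists_chKZeroCoh_eq_sum_smul_complexGysin_one ch hadd hmap μ hX hdp (ι := Unit) (Y := fun _ ↦ Y)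
    (fun _ ↦ hY) (fun _ ↦ g) hF (fun W hW ↦ h0 W (by simpa only [Set.iUnion_const] using hW))
  exact ⟨c (), by simpa only [Finset.univ_unique, Finset.sum_singleton] using hc⟩

/-- **What the span law still needs on a general Gysin generator**: for `g : Y ⟶ X` from a smooth projective `Y` of dimension
`n − p` and ONE coherent `F` supported on `g(Y)` with `ch_p(F) ≠ 0`, the generator `g_* 1_Y` of `Nᵖ H²ᵖ(X(ℂ); ℂ)` lies in
`ℂ · {ch_p(E) : E a vector bundle}` (`ch_p(F) = c • g_* 1_Y` forces `c ≠ 0`, and `ch_p(F)` is a combination of `ch_p` of vector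
bundles, `chKZeroCoh_mem_span`). With `algebraicClasses_eq_span_complexGysin_one`, the span law in degree `p` thus follows from the
non-vanishing of `ch_p(𝒪_Z)` (or of `ch_p` of any coherent sheaf supported on `Z`) for the irreducible codimension-`p` subvarieties `Z`
— the leading coefficient of «`c_p(𝒪_Z) = (−1)^{p−1}(p−1)! [Z]`», not computed here. [cite: Fulton1998, Example 15.3.5 and Example 15.2.16 (b)]
[cite: DeligneHodgeIII1974, Cor. 8.2.8] -/
theorem complexGysin_one_mem_span_ch_of_range_eq_of_ne_zero (μ : OrientationFamily) (hX : IsSmoothProjective n X) {p d : ℕ}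
    (hdp : d + p = n) {Y : SchemeOver ℂ} (hY : IsSmoothProjective d Y) (g : Y ⟶ X) {F : X.left.Modules} (hF : Coh F)
    (h0 : ∀ W : X.left.Opens, Disjoint (W : Set X.left) (Set.range g.left.base) → IsZero ((Scheme.Modules.pullback W.ι).obj F))
    (hne : chKZeroCoh ch hadd hX p (KZeroCoh.of F hF) ≠ 0) :
    complexGysin μ hY hX g (a := 0) (b := 2 * p) (by omega) (singularCohomology.one ℂ (ComplexPoints Y)) ∈
      Submodule.span ℂ {c | ∃ E : X.left.Modules, IsVectorBundle E ∧ ch X E p = c} := by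
  obtain ⟨c, hc⟩ := exists_chKZeroCoh_eq_smul_complexGysin_one_of_range_eq ch hadd hmap μ hX hdp hY g hF h0
  have hc0 : c ≠ 0 := by
    rintro rfl
    exact hne (by rw [hc, zero_smul])
  have hmem := chKZeroCoh_mem_span ch hadd hX p (KZeroCoh.of F hF)
  rw [hc] at hmem
  have h' := Submodule.smul_mem _ c⁻¹ hmem
  rwa [smul_smul, inv_mul_cancel₀ hc0, one_smul] at h'

end ChernDatum

end HodgeTheory

end Literature.AlgebraicGeometry.HodgeTheory

end
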